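import Summits.HubbardSuperconductivity.HubbardSuperconductivity.Theorems.AnisotropyChordTransferFibre3RowDEprim

/-!
# Route `AnisotropyChord` / H0 rotor rung: PartN41-D §4b — `ConvExpansionU` PROVED (the generic one-loop expansion, uniform specs)

Theory-1 g22's PartN41-D §4b `ConvExpansionU` (port …Fibre3KT2aRow): for ANY three uniform factor specs `ψ = (e, u, u′, α, β, γ)`,
`F_ψ(q) = (u + u′e^{−iq·e})(αV[q = 0] + β + γ g(q))`, the one-loop convolution `tconv(F_ψ₃, F_ψ₁, F_ψ₂)(k₂,k₃)` equals
`closedPartU + loopPartU`: the `αVδ` factors collapse the loop momentum (7 closed terms), and the regular triple product expands into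
`Bool³ × (β|γ)³` trig-weighted propagator sums `Eprim r S`.  Pure finite algebra (`g` even is the only input).
★ `convExpansionU_holds : ConvExpansionU L`.
Prover seat `hubbard-h0-rotor-p1` g27 (route lead); helper for stmt-HubbardSuperconductivity-23918 (`--supports`, helper class).
WHAT THIS IS NOT: nothing here proves superconductivity in the Hubbard model.  Tree imports only; no new definitions; no sorry.
-/

set_option linter.dupNamespace false
set_option autoImplicit false

noncomputable section

open scoped BigOperators

namespace Summit.HubbardSuperconductivity.HubbardSuperconductivity.Theorems.AnisotropyChord.Transfer.Fibre3

variable (L : ℕ) [NeZero L]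

namespace RowD

/-- the `δ`-split of a uniform factor: `F_ψ(q) = (αV(u + u′))·[q = 0] + R_ψ(q)`. [folklore] -/
theorem ffacU_split (lam2 : ℝ) (ψ : Tor L × ℝ × ℝ × ℝ × ℝ × ℝ) (q : Tor L) :
    FfacU L lam2 ψ q = (((ψ.2.2.2.1 : ℝ) : ℂ) * (L : ℂ) ^ 2 * ((ψ.2.1 + ψ.2.2.1 : ℝ) : ℂ)) * (if q = 0 then 1 else 0)
      + RfacU L lam2 ψ q := by
  rcases ψ with ⟨e, u, u', α, β, γ⟩
  unfold FfacU RfacU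
  by_cases hq : q = 0
  · subst hq
    simp only [if_true, phase_zero_left, map_one, mul_one]
    push_cast; ring
  · simp only [hq, if_false, zero_add, mul_zero]

/-- `Σ_p [p = 0]·h(p) = h(0)`. [folklore] -/
theorem sum_delta_zero (h : Tor L → ℂ) : (∑ p : Tor L, (if p = 0 then (1 : ℂ) else 0) * h p) = h 0 := by
  simp_rw [boole_mul]; rw [Finset.sum_ite_eq' Finset.univ (0 : Tor L) h]; simp

/-- `Σ_p [k + p = 0]·h(p) = h(−k)`. [folklore] -/
theorem sum_delta_add (k : Tor L) (h : Tor L → ℂ) : (∑ p : Tor L, (if k + p = 0 then (1 : ℂ) else 0) * h p) = h (-k) := by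
  have hiff : ∀ p : Tor L, (k + p = 0) = (p = -k) := fun p => by
    apply propext; constructor
    · intro h1; exact eq_neg_of_add_eq_zero_right h1
    · intro h1; rw [h1, add_neg_cancel]
  simp_rw [hiff, boole_mul]; rw [Finset.sum_ite_eq' Finset.univ (-k) h]; simp

/-- `Σ_p [k − p = 0]·h(p) = h(k)`. [folklore] -/
theorem sum_delta_sub (k : Tor L) (h : Tor L → ℂ) : (∑ p : Tor L, (if k - p = 0 then (1 : ℂ) else 0) * h p) = h k := by
  have hiff : ∀ p : Tor L, (k - p = 0) = (p = k) := fun p => by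
    apply propext; rw [sub_eq_zero, eq_comm]
  simp_rw [hiff, boole_mul]; rw [Finset.sum_ite_eq' Finset.univ k h]; simp

/-- the closed part: collapsing the three `δ`'s, `Σ_p F₃(p)F₁(k₂+p)F₂(k₃−p) = V·closedPartU + Σ_p R₃(p)R₁(k₂+p)R₂(k₃−p)`. [folklore] -/
theorem tconv_numerator_split (lam2 : ℝ) (ψ₃ ψ₁ ψ₂ : Tor L × ℝ × ℝ × ℝ × ℝ × ℝ) (k₂ k₃ : Tor L) :
    (∑ p : Tor L, FfacU L lam2 ψ₃ p * FfacU L lam2 ψ₁ (k₂ + p) * FfacU L lam2 ψ₂ (k₃ - p))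
      = (L : ℂ) ^ 2 * closedPartU L lam2 ψ₃ ψ₁ ψ₂ k₂ k₃
        + ∑ p : Tor L, RfacU L lam2 ψ₃ p * RfacU L lam2 ψ₁ (k₂ + p) * RfacU L lam2 ψ₂ (k₃ - p) := by
  set c₃ : ℂ := ((ψ₃.2.2.2.1 : ℝ) : ℂ) * (L : ℂ) ^ 2 * ((ψ₃.2.1 + ψ₃.2.2.1 : ℝ) : ℂ) with hc₃
  set c₁ : ℂ := ((ψ₁.2.2.2.1 : ℝ) : ℂ) * (L : ℂ) ^ 2 * ((ψ₁.2.1 + ψ₁.2.2.1 : ℝ) : ℂ) with hc₁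
  set c₂ : ℂ := ((ψ₂.2.2.2.1 : ℝ) : ℂ) * (L : ℂ) ^ 2 * ((ψ₂.2.1 + ψ₂.2.2.1 : ℝ) : ℂ) with hc₂
  set F₁ := FfacU L lam2 ψ₁ with hF₁
  set F₂ := FfacU L lam2 ψ₂ with hF₂
  set R₃ := RfacU L lam2 ψ₃ with hR₃
  set R₁ := RfacU L lam2 ψ₁ with hR₁
  set R₂ := RfacU L lam2 ψ₂ with hR₂
  -- step 1: split slot 3 at `p = 0`
  have h1 : (∑ p : Tor L, FfacU L lam2 ψ₃ p * F₁ (k₂ + p) * F₂ (k₃ - p))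
      = c₃ * (F₁ k₂ * F₂ k₃) + ∑ p : Tor L, R₃ p * F₁ (k₂ + p) * F₂ (k₃ - p) := by
    have : ∀ p : Tor L, FfacU L lam2 ψ₃ p * F₁ (k₂ + p) * F₂ (k₃ - p)
        = c₃ * ((if p = 0 then (1 : ℂ) else 0) * (F₁ (k₂ + p) * F₂ (k₃ - p))) + R₃ p * F₁ (k₂ + p) * F₂ (k₃ - p) := by
      intro p; rw [ffacU_split]; ring
    simp_rw [this]
    rw [Finset.sum_add_distrib, ← Finset.mul_sum, sum_delta_zero L (fun p => F₁ (k₂ + p) * F₂ (k₃ - p))]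
    simp only [add_zero, sub_zero]
  -- step 2: split slot 1 at `p = −k₂`
  have h2 : (∑ p : Tor L, R₃ p * F₁ (k₂ + p) * F₂ (k₃ - p))
      = c₁ * (R₃ (-k₂) * F₂ (k₂ + k₃)) + ∑ p : Tor L, R₃ p * R₁ (k₂ + p) * F₂ (k₃ - p) := by
    have : ∀ p : Tor L, R₃ p * F₁ (k₂ + p) * F₂ (k₃ - p)
        = c₁ * ((if k₂ + p = 0 then (1 : ℂ) else 0) * (R₃ p * F₂ (k₃ - p))) + R₃ p * R₁ (k₂ + p) * F₂ (k₃ - p) := by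
      intro p; rw [hF₁, ffacU_split]; ring
    simp_rw [this]
    rw [Finset.sum_add_distrib, ← Finset.mul_sum, sum_delta_add L k₂ (fun p => R₃ p * F₂ (k₃ - p))]
    simp only [sub_neg_eq_add, add_comm k₃ k₂]
  -- step 3: split slot 2 at `p = k₃`
  have h3 : (∑ p : Tor L, R₃ p * R₁ (k₂ + p) * F₂ (k₃ - p))
      = c₂ * (R₃ k₃ * R₁ (k₂ + k₃)) + ∑ p : Tor L, R₃ p * R₁ (k₂ + p) * R₂ (k₃ - p) := by
    have : ∀ p : Tor L, R₃ p * R₁ (k₂ + p) * F₂ (k₃ - p)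
        = c₂ * ((if k₃ - p = 0 then (1 : ℂ) else 0) * (R₃ p * R₁ (k₂ + p))) + R₃ p * R₁ (k₂ + p) * R₂ (k₃ - p) := by
      intro p; rw [hF₂, ffacU_split]; ring
    simp_rw [this]
    rw [Finset.sum_add_distrib, ← Finset.mul_sum, sum_delta_sub L k₃ (fun p => R₃ p * R₁ (k₂ + p))]
  rw [h1, h2, h3, hF₁, hF₂, ffacU_split L lam2 ψ₁ k₂, ffacU_split L lam2 ψ₂ k₃, ffacU_split L lam2 ψ₂ (k₂ + k₃)]
  unfold closedPartU
  simp only []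
  rw [hc₃, hc₁, hc₂, hR₃, hR₁, hR₂]
  push_cast
  ring

/-- a regular pattern sum in closed form: `loopPat(toPat ψ₃, toPat ψ₁, toPat ψ₂)(r) = (1/V)Σ_p e^{−ip·r}(β₃ + γ₃g(p))(β₁ + γ₁g(p+k₂))(β₂ + γ₂g(p−k₃))`. [folklore] -/
theorem loopPat_toPat (lam2 : ℝ) (ψ₃ ψ₁ ψ₂ : Tor L × ℝ × ℝ × ℝ × ℝ × ℝ) (k₂ k₃ r : Tor L) :
    loopPat L lam2 (toPat L ψ₃) (toPat L ψ₁) (toPat L ψ₂) k₂ k₃ r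
      = (∑ p : Tor L, (starRingEnd ℂ) (phase L p r) *
          ( (((ψ₃.2.2.2.2.1 : ℝ) : ℂ) + ((ψ₃.2.2.2.2.2 : ℝ) : ℂ) * ((gres L lam2 p : ℝ) : ℂ))
          * (((ψ₁.2.2.2.2.1 : ℝ) : ℂ) + ((ψ₁.2.2.2.2.2 : ℝ) : ℂ) * ((gres L lam2 (p + k₂) : ℝ) : ℂ))
          * (((ψ₂.2.2.2.2.1 : ℝ) : ℂ) + ((ψ₂.2.2.2.2.2 : ℝ) : ℂ) * ((gres L lam2 (p + -k₃) : ℝ) : ℂ)) )) / (L : ℂ) ^ 2 := by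
  unfold loopPat toPat Eprim
  simp only [List.map_cons, List.map_nil, List.prod_cons, List.prod_nil, mul_one, add_zero]
  simp only [mul_div_assoc', Finset.mul_sum, ← add_div, ← Finset.sum_add_distrib]
  congr 1
  refine Finset.sum_congr rfl (fun p _ => ?_)
  ring

/-- the loop part: `(1/V)Σ_p R₃(p)R₁(k₂+p)R₂(k₃−p) = loopPartU` (expand the three trig weights over `Bool³`). [folklore] -/
theorem tconv_loop_eq (lam2 : ℝ) (ψ₃ ψ₁ ψ₂ : Tor L × ℝ × ℝ × ℝ × ℝ × ℝ) (k₂ k₃ : Tor L) :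
    (∑ p : Tor L, RfacU L lam2 ψ₃ p * RfacU L lam2 ψ₁ (k₂ + p) * RfacU L lam2 ψ₂ (k₃ - p)) / (L : ℂ) ^ 2
      = loopPartU L lam2 ψ₃ ψ₁ ψ₂ k₂ k₃ := by
  unfold loopPartU
  simp only [List.flatMap_cons, List.flatMap_nil, List.map_cons, List.map_nil, List.sum_append, List.sum_cons, List.sum_nil,
    List.append_nil, add_zero, Bool.false_eq_true, if_true, if_false]
  simp only [loopPat_toPat]
  simp only [mul_div_assoc', Finset.mul_sum, ← add_div, ← Finset.sum_add_distrib]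
  congr 1
  refine Finset.sum_congr rfl (fun p _ => ?_)
  rcases ψ₃ with ⟨e₃, u₃, u₃', α₃, β₃, γ₃⟩
  rcases ψ₁ with ⟨e₁, u₁, u₁', α₁, β₁, γ₁⟩
  rcases ψ₂ with ⟨e₂, u₂, u₂', α₂, β₂, γ₂⟩
  unfold RfacU
  simp only []
  have hg2 : gres L lam2 (k₃ - p) = gres L lam2 (p + -k₃) := by
    rw [← B1.gres_neg L lam2 (k₃ - p), neg_sub, sub_eq_add_neg]
  have hg1 : gres L lam2 (k₂ + p) = gres L lam2 (p + k₂) := by rw [add_comm]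
  have hφ1 : (starRingEnd ℂ) (phase L (k₂ + p) e₁) = (starRingEnd ℂ) (phase L k₂ e₁) * (starRingEnd ℂ) (phase L p e₁) := by
    rw [phase_add_left, map_mul]
  have hφ2 : (starRingEnd ℂ) (phase L (k₃ - p) e₂) = (starRingEnd ℂ) (phase L k₃ e₂) * (starRingEnd ℂ) (phase L p (-e₂)) := by
    rw [sub_eq_add_neg, phase_add_left, phase_neg_left, map_mul]
  rw [hg2, hg1, hφ1, hφ2]
  simp only [zero_add, sub_eq_add_neg, neg_zero, add_zero, phase_add, phase_zero, map_one, map_mul, mul_one]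
  push_cast
  ring

end RowD

/-- ★ **`ConvExpansionU L` holds.** [folklore] -/
theorem convExpansionU_holds : ConvExpansionU L := by
  intro lam2 ψ₃ ψ₁ ψ₂ k₂ k₃
  have hV : (L : ℂ) ^ 2 ≠ 0 := pow_ne_zero 2 (Nat.cast_ne_zero.mpr (NeZero.ne L))
  unfold tconv
  rw [RowD.tconv_numerator_split, add_div, RowD.tconv_loop_eq, mul_div_cancel_left₀ _ hV]

end Summit.HubbardSuperconductivity.HubbardSuperconductivity.Theorems.AnisotropyChord.Transfer.Fibre3

end
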